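/- Copyright: the b2b-balaban cell (near-miss cell 7), T⁴-continuum fan-out; row NE7b OWNER lineage `t4-ne7b-p1`
(gen 58) — the refuter's located question Q-ref-g31-1 (a) (PRICING-NE7b v31 F176) in the kernel, part 2 of 2 (at the
letters of record): «THE KEY DOES NOT PIN THE OUTER SUMMAND».  Released under the licence of the surrounding project. -/
import Summits.QuantumFields.BalabanUV.T4Continuum.Support.HistoryBankingFibreOuterSummand
import Summits.QuantumFields.BalabanUV.T4Continuum.Support.HistoryRealiseCellsRunAssemblyWTVSData

/-!
# The outer summand of (1.72) on a key fibre, part 2: AT THE LETTERS OF RECORD the key family FACTORS THROUGH THE RUN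
READ OFF THE HISTORY CHOICE, so the typed letters do NOT pin the outer summand — a decided toy with two slices in one
key fibre; the answer to Q-ref-g31-1 (a)

Summits-side support leaf of the T⁴-continuum cell (rung (B)+1 on a FINITE torus only; NOT infinite volume, NOT the
mass gap, NOT the Clay statement; NOT a proof of the spine estimate NE7b — the cell's OWN estimate, NOT PRINTED, NOT
PROVED).  [folklore] `rfl`-grade bookkeeping over M2 brick B's reading data (`B16HistoryInputFamily`: `HistReading`,
`runOf`, `inputOf`; pass-V carriers `InputFamily.pedV`∕`liveCV` of `HistoryGenealogyJunctionV`), the END's member ∕ key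
maps (`HistoryAssemblyPedigree.memOf`, `HistoryAssemblyMultKey.kmemOf`∕`keyOf`, `HistoryRealiseCellsRun.cellOfR`,
`HistoryJoinsPlacedMult.physV`) and the (α) record's carriers (`HistoryRealiseCellsRunAssemblyWTVSData`: `cellA`, `memA`,
`physA`, `kmemA`), over part 1 (`HistoryBankingFibreOuterSummand`: `OuterPinnedAt`, `CslOf`∕`cMet` bookkeeping); a
decided toy; no `structure`, no `[cite:]` tag, no `def … : Prop`, nothing of Bałaban's, zero `sorry`.  B16 =
[Balaban1989LargeFieldII] (1.71)∕(1.72) pp. 378–379 is quoted as LOCATOR only.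

WHY.  Part 1 showed, for any key map, that the outer-summand multiplicity per key sits inside (ρ2)'s one inequality and
that a displayed pinning clause `OuterPinnedAt kmem K k` would make it `1`.  Q-ref-g31-1 (a) asks whether AT THE KEY
MAP OF RECORD `kmemA` (root cell, flat genealogy, physical datum of the live components, read off `ℛ.inputOf.pedV` ∕
`liveCV`) the clause HOLDS — «from `index_inj` + which fields of the reading».  It does NOT, as typed: every carrier of
the key reads the term `⟨K, a, ι⟩` only through THE RUN `ℛ.runOf K a ι` its history choice determines, and `HistReading`
(pure data `N`∕`cls`∕`F` per `(K, a, ι)`) carries NO clause relating that run to the skeleton's region families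
`Zc a`∕`Ys a` — so `index_inj` has nothing to act on, and two outer summands whose choices read ONE run share ONE key.

WHAT.  §1 congruence: `kmemOf_congr`, `memOf_congr`, `cellOfR_congr`, `physV_congr` (the key ∕ member ∕ root-cell ∕
physical-datum maps read a term only through its pedigree, live names and cell payload).  §2 at the reading:
`pedV_inputOf_mk`∕`liveCV_inputOf_mk` (`rfl`: the pass-V pedigree and live names of `⟨K, a, ι⟩` are those of
`ℛ.runOf K a ι`), `pedV_`∕`liveCV_`∕`cellA_`∕`physA_`∕`memA_mk_eq_of_runOf_eq` and **`kmemA_mk_eq_of_runOf_eq`**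
(`ℛ.runOf K a ι = ℛ.runOf K a′ ι′ → kmemA n L hn hL ℛ K ⟨K, a, ι⟩ = kmemA n L hn hL ℛ K ⟨K, a′, ι′⟩`),
**`mem_fibre_kmemA_of_runOf_eq`** (two level terms with one run lie in one key fibre) and
**`not_outerPinnedAt_kmemA_of_runOf_eq`** (with distinct outer summands the pinning clause FAILS on that fibre).  §3 A
DECIDED TOY: the two-summand skeleton `I₂` (`Adm = Bool`, `Zc true = {()}`, `Zc false = ∅` — `index_inj` holds
non-vacuously —, one history pair, one curly summand) with the region-free reading `ℛ₂ d` (no regions, no new-field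
cubes): `runOf_const` (`rfl`), the level terms `τt K`∕`τf K` share the key `k₂ d K := kmemA 1 1 … (ℛ₂ d) K (τt K)`
(`τt_mem_fibre`, `τf_mem_fibre`), **`not_outerPinnedAt_toy`**, `two_slices_toy`, `CslOf_toy` and **`card_CslOf_toy`**: the
fibre of the one key meets EXACTLY TWO slices, one per outer summand — the outer-summand multiplicity of a key of record
CAN exceed one.

ANSWER TO Q-ref-g31-1 (a) (census-neutral; no tag ∕ class ∕ NEEDS-CONSTANT move).  AS TYPED, NOT PINNED (§2∕§3): neither
`index_inj` nor any field of `HistReading`∕`HistFactors`∕the record's input rows speaks of it.  PINNED EXACTLY under the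
displayed clause `OuterPinnedAt (kmemA …) K k` on the bad keys — an (ID)-class READING («distinct outer summands
`(Z_K, {Y_i})` of (1.72) read distinct live data at `K`»; with it `index_inj` is idle, the clause IS the pin); nobody
displays it and no consumer needs it: the END consumes (ρ2) through `supSum ≤ W K` only.  BOOKING: the outer-summand
multiplicity per key is part of (ρ2)'s VALUE `W K` (WALL row (ρ), MAP sub-row 2.8.11) — T-extensive with `W∞` unless
that clause is displayed, `= 1` under it (part 1 `card_CslOf_le_of_pinned`∕`supSum_eq_of_pinned`).

HONEST SCOPE.  `rfl`-grade bookkeeping on OUR carriers and a decided toy; nothing of Bałaban's read anew, asserted,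
valued or discharged; no record touched.  BY-NAME EFFECT ON THE WALL: NONE beyond part 1's wording of (ρ2)'s residue;
R∕T-rows by count UNCHANGED.  NE7b NOT PRINTED ∕ NOT PROVED; spine 0∕9.  HONEST DEPENDENCY (cell): continuum YM on T⁴ ⇐
BetaPertH ∧ nine spine estimates (0/9 proved); BetaPertH ⇐ (D1) ∧ (D4) ∧ CAP+tail; G-an2-4 gates asym, D1 and NE2/3/4.
This file changes none of it.
-/

open Finset
open Literature.MathematicalPhysics.QuantumFieldTheory.Balaban1983to89
open T4PersistenceDictionary T4LiveClassFibration
open Literature.MathematicalPhysics.QuantumFieldTheory.Balaban1983to89.B13ScaleTransfer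
open Summit.QuantumFields.BalabanUV.T4Continuum.HistoryGen
open Summit.QuantumFields.BalabanUV.T4Continuum.HistoryGenealogyInstantiate
open Summit.QuantumFields.BalabanUV.T4Continuum.HistoryAssemblyPedigree
open Summit.QuantumFields.BalabanUV.T4Continuum.HistoryAssemblyMultKey
open Summit.QuantumFields.BalabanUV.T4Continuum.HistoryBankingFibreDecorSlice
open Summit.QuantumFields.BalabanUV.T4Continuum.HistoryBankingFibreCount
open Summit.QuantumFields.BalabanUV.T4Continuum.HistoryBankingFibreOuterSummand
open Summit.QuantumFields.BalabanUV.T4Continuum.B16HistoryIndexedRepr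
open Summit.QuantumFields.BalabanUV.T4Continuum.HistoryRealiseCellsRunAssemblyWTVSData

namespace Summit.QuantumFields.BalabanUV.T4Continuum.HistoryBankingFibreOuterSummandRecord

noncomputable section

-- the structural `DecidableEq` instance of the concrete key type of record exceeds the default synthesis size (as in
-- `HistoryRealiseCellsRunAssemblyWTVSData` and its siblings)
set_option synthInstance.maxSize 1024

variable {DomK : ℕ → Type*} {I : (K : ℕ) → HIndex (DomK K)}

/-! ## §1 Congruence: the key ∕ member ∕ root-cell ∕ physical-datum maps read a term through its pedigree -/

section Congr

variable {ι' α π γ δ' : Type*} [DecidableEq α] [DecidableEq π] [DecidableEq γ] [DecidableEq δ']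

omit [DecidableEq α] [DecidableEq π] in
/-- the key family of a term reads the term only through its pedigree, live names, root-cell map and physical datum
[folklore] -/
theorem kmemOf_congr {ped : ℕ → ι' → Pedigree α π} {liveC : ℕ → ι' → Finset α} {cellOf : ℕ → ι' → α → γ}
    {phys : ℕ → ι' → α → δ'} {K : ℕ} {τ τ' : ι'} (hp : ped K τ = ped K τ') (hl : liveC K τ = liveC K τ')
    (hc : cellOf K τ = cellOf K τ') (hph : phys K τ = phys K τ') :
    kmemOf ped liveC cellOf phys K τ = kmemOf ped liveC cellOf phys K τ' := by
  unfold kmemOf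
  rw [hl]
  refine Finset.image_congr fun c _ => ?_
  unfold keyOf
  rw [hp, hc, hph]

omit [DecidableEq δ'] in
/-- … and so does the named member family [folklore] -/
theorem memOf_congr {ped : ℕ → ι' → Pedigree α π} {liveC : ℕ → ι' → Finset α} {cellOf : ℕ → ι' → α → γ}
    {K : ℕ} {τ τ' : ι'} (hp : ped K τ = ped K τ') (hl : liveC K τ = liveC K τ') (hc : cellOf K τ = cellOf K τ') :
    memOf ped liveC cellOf K τ = memOf ped liveC cellOf K τ' := by
  unfold memOf
  rw [hl, hp, hc]

omit [DecidableEq α] [DecidableEq π] in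
/-- the per-run root-cell map reads the term only through its pedigree and cell payload [folklore] -/
theorem cellOfR_congr {d : ℕ} (n L : ℕ) (s : ℕ → ℕ → ℕ) {ped : ℕ → ι' → Pedigree α π}
    {cellP : ℕ → ι' → π → Pt d × Finset (Pt d)} {K : ℕ} {τ τ' : ι'} (hp : ped K τ = ped K τ')
    (hc : cellP K τ = cellP K τ') :
    HistoryRealiseCellsRun.cellOfR n L s ped cellP K τ = HistoryRealiseCellsRun.cellOfR n L s ped cellP K τ' := by
  unfold HistoryRealiseCellsRun.cellOfR
  rw [hp, hc]

omit [DecidableEq α] [DecidableEq π] in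
/-- the physical datum of record reads the term only through its pedigree and cell payload [folklore] -/
theorem physV_congr {d : ℕ} (n L : ℕ) (hn : 0 < n) (hL : 0 < L) (M : ℕ → ℕ) (hM : ∀ K, 1 ≤ M K) (s : ℕ → ℕ → ℕ)
    {ped : ℕ → ι' → Pedigree α π} {cellP : ℕ → ι' → π → Pt d × Finset (Pt d)} {K : ℕ} {τ τ' : ι'}
    (hp : ped K τ = ped K τ') (hc : cellP K τ = cellP K τ') :
    HistoryJoinsPlacedMult.physV n L hn hL M hM s ped cellP K τ =
      HistoryJoinsPlacedMult.physV n L hn hL M hM s ped cellP K τ' := by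
  funext c
  unfold HistoryJoinsPlacedMult.physV
  rw [hp, hc]

end Congr

/-! ## §2 At the letters of record: the key family FACTORS THROUGH THE RUN READ OFF THE HISTORY CHOICE -/

section Record

variable {d : ℕ} (ℛ : HistReading I d)

/-- the pass-V pedigree of the term `⟨K, a, ι⟩` IS that of the run read off its history choice (`rfl`) [folklore] -/
theorem pedV_inputOf_mk (K : ℕ) (a : (I K).Adm) (ι : (I K).HZ × (I K).HL × (I K).HC) :
    ℛ.inputOf.pedV K ⟨K, a, ι⟩ = (ℛ.runOf K a ι).pedMV := rfl

/-- the pass-V live names of the term `⟨K, a, ι⟩` ARE those of the run read off its history choice (`rfl`) [folklore] -/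
theorem liveCV_inputOf_mk (K : ℕ) (a : (I K).Adm) (ι : (I K).HZ × (I K).HL × (I K).HC) :
    ℛ.inputOf.liveCV K ⟨K, a, ι⟩ = ((ℛ.runOf K a ι).histV.comp K).image (Prod.mk K) := rfl

variable {ℛ} {K : ℕ} {a a' : (I K).Adm} {ι ι' : (I K).HZ × (I K).HL × (I K).HC}

/-- two level terms with ONE run have ONE pass-V pedigree [folklore] -/
theorem pedV_mk_eq_of_runOf_eq (hrun : ℛ.runOf K a ι = ℛ.runOf K a' ι') :
    ℛ.inputOf.pedV K ⟨K, a, ι⟩ = ℛ.inputOf.pedV K ⟨K, a', ι'⟩ := by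
  rw [pedV_inputOf_mk, pedV_inputOf_mk, hrun]

/-- … ONE live-name family [folklore] -/
theorem liveCV_mk_eq_of_runOf_eq (hrun : ℛ.runOf K a ι = ℛ.runOf K a' ι') :
    ℛ.inputOf.liveCV K ⟨K, a, ι⟩ = ℛ.inputOf.liveCV K ⟨K, a', ι'⟩ := by
  rw [liveCV_inputOf_mk, liveCV_inputOf_mk, hrun]

/-- … ONE root-cell map at the reading [folklore] -/
theorem cellA_mk_eq_of_runOf_eq (n L : ℕ) (hrun : ℛ.runOf K a ι = ℛ.runOf K a' ι') :
    cellA n L ℛ K ⟨K, a, ι⟩ = cellA n L ℛ K ⟨K, a', ι'⟩ :=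
  cellOfR_congr n L _ (pedV_mk_eq_of_runOf_eq hrun) rfl

/-- … ONE physical datum of record at the reading [folklore] -/
theorem physA_mk_eq_of_runOf_eq (n L : ℕ) (hn : 0 < n) (hL : 0 < L) (hrun : ℛ.runOf K a ι = ℛ.runOf K a' ι') :
    physA n L hn hL ℛ K ⟨K, a, ι⟩ = physA n L hn hL ℛ K ⟨K, a', ι'⟩ :=
  physV_congr n L hn hL _ _ _ (pedV_mk_eq_of_runOf_eq hrun) rfl

/-- … ONE named member family at the reading [folklore] -/
theorem memA_mk_eq_of_runOf_eq (n L : ℕ) (hrun : ℛ.runOf K a ι = ℛ.runOf K a' ι') :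
    memA n L ℛ K ⟨K, a, ι⟩ = memA n L ℛ K ⟨K, a', ι'⟩ :=
  memOf_congr (pedV_mk_eq_of_runOf_eq hrun) (liveCV_mk_eq_of_runOf_eq hrun) (cellA_mk_eq_of_runOf_eq n L hrun)

/-- **THE KEY FAMILY OF RECORD FACTORS THROUGH THE RUN READ OFF THE HISTORY CHOICE**: two level terms `⟨K, a, ι⟩`,
`⟨K, a′, ι′⟩` whose readings give ONE input of print's process (`ℛ.runOf K a ι = ℛ.runOf K a′ ι′`) have ONE key family
— whatever their outer summands.  `HistReading` carries no clause relating `runOf K a ι` to the skeleton's region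
families `Zc a`∕`Ys a`, so `index_inj` has nothing to act on. [folklore] -/
theorem kmemA_mk_eq_of_runOf_eq (n L : ℕ) (hn : 0 < n) (hL : 0 < L) (hrun : ℛ.runOf K a ι = ℛ.runOf K a' ι') :
    kmemA n L hn hL ℛ K ⟨K, a, ι⟩ = kmemA n L hn hL ℛ K ⟨K, a', ι'⟩ :=
  kmemOf_congr (pedV_mk_eq_of_runOf_eq hrun) (liveCV_mk_eq_of_runOf_eq hrun) (cellA_mk_eq_of_runOf_eq n L hrun)
    (physA_mk_eq_of_runOf_eq n L hn hL hrun)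

/-- **TWO LEVEL TERMS WITH ONE RUN LIE IN ONE KEY FIBRE OF RECORD.** [folklore] -/
theorem mem_fibre_kmemA_of_runOf_eq (n L : ℕ) (hn : 0 < n) (hL : 0 < L) (hrun : ℛ.runOf K a ι = ℛ.runOf K a' ι')
    (hι' : ι' ∈ (I K).LIdx a') :
    (⟨K, a', ι'⟩ : HIndex.Idx I) ∈
      fibre (kmemA n L hn hL ℛ) (HIndex.termSet I) K (kmemA n L hn hL ℛ K ⟨K, a, ι⟩) :=
  mem_fibre.2 ⟨mk_mem_termSet_iff.2 hι', (kmemA_mk_eq_of_runOf_eq n L hn hL hrun).symm⟩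

/-- **HENCE THE KEY OF RECORD DOES NOT PIN THE OUTER SUMMAND** whenever two level terms with DISTINCT outer summands
read ONE run: the pinning clause FAILS on their common key fibre. [folklore] -/
theorem not_outerPinnedAt_kmemA_of_runOf_eq (n L : ℕ) (hn : 0 < n) (hL : 0 < L) (hne : a ≠ a')
    (hrun : ℛ.runOf K a ι = ℛ.runOf K a' ι') (hι : ι ∈ (I K).LIdx a) (hι' : ι' ∈ (I K).LIdx a') :
    ¬ OuterPinnedAt (kmemA n L hn hL ℛ) K (kmemA n L hn hL ℛ K ⟨K, a, ι⟩) := fun hpin =>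
  hne (hpin a a' ι ι' (mem_fibre.2 ⟨mk_mem_termSet_iff.2 hι, rfl⟩) (mem_fibre_kmemA_of_runOf_eq n L hn hL hrun hι'))

end Record

/-! ## §3 A decided toy: two outer summands, one run, one key fibre, two slices -/

namespace Toy

/-- **THE TWO-SUMMAND SKELETON** at every cutoff: `Adm = Bool` with `Zc true = {()}`, `Zc false = ∅` (so `index_inj`
holds, and not by subsingleton), `Ys = ∅`, one history of the new region, one sub-history choice, one curly summand;
the all-small summand is `false`. [folklore] -/
def I₂ : (K : ℕ) → HIndex Unit := fun _ =>
  { Adm := Bool, Zc := fun b => bif b then {()} else ∅, Ys := fun _ => ∅,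
    index_inj := fun a b hZ _ => by
      cases a <;> cases b <;> first | rfl | exact absurd hZ (by simp),
    HZ := Unit, HL := Unit, HC := Unit, HZs := fun _ => {()}, HYs := fun _ => {()}, HCs := fun _ => {()},
    allSmall := false, Zc_allSmall := rfl, Ys_allSmall := rfl, hz₀ := (), HZs_allSmall := rfl, hl₀ := (),
    HYs_allSmall := rfl }

/-- **THE REGION-FREE READING** over the two-summand skeleton: no new regions, no new-field cubes, at any choice —
every history choice of every outer summand reads ONE AND THE SAME input of print's process. [folklore] -/
def ℛ₂ (d : ℕ) : HistReading I₂ d :=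
  { L := 1, s := fun _ _ => 0, R := fun _ _ => 0, Rm := fun _ _ _ => 0, N := fun _ _ _ _ => ∅,
    cls := fun _ _ _ _ => 0, F := fun _ _ _ _ => ∅ }

/-- the level term of outer summand `true` [folklore] -/
def τt (K : ℕ) : HIndex.Idx I₂ := ⟨K, true, ((), (), ())⟩

/-- the level term of outer summand `false` [folklore] -/
def τf (K : ℕ) : HIndex.Idx I₂ := ⟨K, false, ((), (), ())⟩

/-- the one history choice lies in the level's index set of either outer summand [folklore] -/
theorem choice_mem (K : ℕ) (b : (I₂ K).Adm) : (((), (), ()) : Unit × Unit × Unit) ∈ (I₂ K).LIdx b :=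
  Finset.mem_product.2 ⟨Finset.mem_singleton_self _,
    Finset.mem_product.2 ⟨Finset.mem_singleton_self _, Finset.mem_singleton_self _⟩⟩

/-- the run read off any choice of any outer summand is one and the same (`rfl`) [folklore] -/
theorem runOf_const (d K : ℕ) (a a' : (I₂ K).Adm) (ι ι' : (I₂ K).HZ × (I₂ K).HL × (I₂ K).HC) :
    (ℛ₂ d).runOf K a ι = (ℛ₂ d).runOf K a' ι' := rfl

variable (d : ℕ)

/-- **THE COMMON KEY** of the two level terms: the key family of record of `τt K` at `n = L = 1`. [folklore] -/
def k₂ (K : ℕ) : Finset ((Fin d → ℕ) × Gen PEv × Multiset (PEv × ((Fin d → ℕ) × Finset (Pt d)))) :=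
  kmemA 1 1 Nat.one_pos Nat.one_pos (ℛ₂ d) K (τt K)

/-- the `true` term lies in the fibre of the common key [folklore] -/
theorem τt_mem_fibre (K : ℕ) :
    τt K ∈ fibre (kmemA 1 1 Nat.one_pos Nat.one_pos (ℛ₂ d)) (HIndex.termSet I₂) K (k₂ d K) := by
  refine mem_fibre.2 ⟨mk_mem_termSet_iff.2 (choice_mem K true), ?_⟩
  unfold k₂
  rfl

/-- **THE `false` TERM LIES IN THE SAME FIBRE** (§2: one run, one key). [folklore] -/
theorem τf_mem_fibre (K : ℕ) :
    τf K ∈ fibre (kmemA 1 1 Nat.one_pos Nat.one_pos (ℛ₂ d)) (HIndex.termSet I₂) K (k₂ d K) :=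
  mem_fibre_kmemA_of_runOf_eq 1 1 Nat.one_pos Nat.one_pos (runOf_const d K true false _ _) (choice_mem K false)

/-- **CONTENT: THE KEY OF RECORD DOES NOT PIN THE OUTER SUMMAND** — on the toy the pinning clause is FALSE at every
cutoff. [folklore] -/
theorem not_outerPinnedAt_toy (K : ℕ) :
    ¬ OuterPinnedAt (kmemA 1 1 Nat.one_pos Nat.one_pos (ℛ₂ d)) K (k₂ d K) :=
  not_outerPinnedAt_kmemA_of_runOf_eq 1 1 Nat.one_pos Nat.one_pos (fun h => Bool.noConfusion h)
    (runOf_const d K true false _ _) (choice_mem K true) (choice_mem K false)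

/-- **TWO SLICES WITH DISTINCT OUTER SUMMANDS ARE MET IN THE ONE FIBRE.** [folklore] -/
theorem two_slices_toy (K : ℕ) :
    (⟨K, true, ()⟩ : SIdx I₂) ∈ CslOf I₂ (kmemA 1 1 Nat.one_pos Nat.one_pos (ℛ₂ d)) K (k₂ d K) ∧
      (⟨K, false, ()⟩ : SIdx I₂) ∈ CslOf I₂ (kmemA 1 1 Nat.one_pos Nat.one_pos (ℛ₂ d)) K (k₂ d K) ∧
      (⟨K, true, ()⟩ : SIdx I₂) ≠ ⟨K, false, ()⟩ :=
  ⟨sliceOf_mem_CslOf (τt_mem_fibre d K), sliceOf_mem_CslOf (τf_mem_fibre d K), fun h =>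
    Bool.noConfusion (sliceOf_eq_iff.1 (show sliceOf I₂ (τt K) = sliceOf I₂ (τf K) from h)).1⟩

open Classical in
/-- **THE SLICES MET IN THE ONE FIBRE ARE EXACTLY THE TWO** (one per outer summand). [folklore] -/
theorem CslOf_toy (K : ℕ) :
    CslOf I₂ (kmemA 1 1 Nat.one_pos Nat.one_pos (ℛ₂ d)) K (k₂ d K) = {⟨K, true, ()⟩, ⟨K, false, ()⟩} := by
  ext s
  rw [Finset.mem_insert, Finset.mem_singleton]
  constructor
  · intro hs
    obtain ⟨a, c, -, rfl⟩ := exists_eq_of_mem_CslOf hs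
    cases c
    cases a
    · exact Or.inr rfl
    · exact Or.inl rfl
  · rintro (rfl | rfl)
    · exact (two_slices_toy d K).1
    · exact (two_slices_toy d K).2.1

open Classical in
/-- **THE OUTER-SUMMAND MULTIPLICITY OF THE COMMON KEY IS TWO.** [folklore] -/
theorem card_CslOf_toy (K : ℕ) : (CslOf I₂ (kmemA 1 1 Nat.one_pos Nat.one_pos (ℛ₂ d)) K (k₂ d K)).card = 2 := by
  rw [CslOf_toy, Finset.card_pair (two_slices_toy d K).2.2]

end Toy

end

end Summit.QuantumFields.BalabanUV.T4Continuum.HistoryBankingFibreOuterSummandRecord
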